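import Literature.NumberTheory.Automorphic.UnitaryThreeAnisotropicStabilizerBounds    -- ★ p841597 (B-p14): LAYER B′ step 1 (unitarity relations, valuation bounds; brings ★ (C′) p841385)
import HarnessLib

/-!
# The anisotropic stabiliser `Stab(w₀)` in `(b, q, r, s)` coordinates: `r` and `N(A)` eliminated, the `2 × 2` model `M_h = [[A, q], [4ϖr, s]]` is multiplicative,
# and `H′_m` is cut out by `|q| ≤ |ϖ^m|`, `|A − 1| ≤ |ϖ^{2m+1}|` (Flicker 1998, Prop. 4 p. 82, Prop. 16 p. 96) — LAYER B′ step 2, FILE 1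

Topic `NumberTheory/Automorphic`; namespace `Literature.NumberTheory.Automorphic.UnitaryGroup`.  THEOREMS ONLY (no `def`, no instance, no notation, no named fact, no
`sorry`; count-neutral).  Cell `pub/hodgecm-mathlib`, F0∕P3a road «D-N7-inert», line «N7nsCount» (`stub_irredGValuePos∕Neg`, (F11-c)); B-p14 (g30)'s DESIGN NOTE v2
`DESIGN-F11c-LayerBprime-step2` (7196d027), FILE 1 «COORDINATES» dealt to this seat (LEAD F0P3a-plan (g9), 2026-09-01T05:56Z).  Frame = ★ (C′) p841385 (B-p17) ∕ ★
Bounds p841597 (B-p14): `K` valued in `ℤᵐ⁰`, `hd : LocalConjDatum σ ϖ`, `J = Φ₃`, `h ∈ U(σ, J)` with `↑↑h = !![1+2ϖb, q, b; 2ϖr, s, r; 4ϖ²b, 2ϖq, 1+2ϖb]`, `A := 1 + 4ϖb`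
spelled out.  HONEST LABEL: HC_CM is proved only modulo the printed citations until rung 0 closes; coordinates here, no count yet.

THE MATHEMATICS.  From the unitarity relations (U1) `N(A) + 4ϖN(r) = 1`, (U2) `N(s) + 4ϖN(q) = 1`, (U3) `σA·q + σr·s = 0` (★ `stabilizer_unitarity_relations`) and `|s| = 1`:
(§1) **`r = −A·σq ∕ σs`** (`stabilizer_r_eq`), hence `|r| = |q|`; substituting in (U1) and using (U2), **`N(A) = N(s)`** (`stabilizer_norm_A_eq_norm_s`); and
**`det M_h = A·s − 4ϖ·q·r = A ∕ σs`** (`det_stabilizerModel_eq`) — so `S := Stab(w₀) ≅ {(A, q, s) : N(s) + 4ϖN(q) = 1, N(A) = N(s)}`.  (§2) **`H′_m` BY TWO CONGRUENCES**: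
`d_m⁻¹ h d_m ∈ K₀ ↔ |q| ≤ |ϖ^m| ∧ |A − 1| ≤ |ϖ^{2m+1}|` (★ (C′)'s four congruences with `|r| = |q|`, `|s| = 1` automatic and `|b| ≤ |ϖ^m|² ⟺ |4ϖb| ≤ |ϖ^{2m+1}|`) =
Flicker's `{c ∈ π^m R_E, a∕u ≡ e (mod π^{1+2m})}`.  (§3) **THE `2 × 2` MODEL IS MULTIPLICATIVE**: reading `h ↦ M_h = [[1+4ϖb, q], [4ϖr, s]]` (the matrix of `h` on
`W = w₀^⊥` in the basis `f₁ = e₀ + 2ϖe₂`, `f₂ = e₁`, ★ `stabilizer_mulVec_fOne∕fTwo`), `M_{hh′} = M_h · M_{h′}` (`stabilizerModel_mul`) and `M_h` determines `h`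
(`stabilizer_ext_of_model`) — the monomorphism `S ↪ GL₂(K)` along which the coset criterion `h⁻¹h′ ∈ H′_m` of FILE 2 is computed (`M_{h⁻¹h′} = M_h⁻¹M_{h′}`).

## References
* [Flicker1998UnitaryFL] Y. Z. Flicker, *Elementary proof of the fundamental lemma for a unitary group*, Canad. J. Math. 50 (1998), Prop. 4 pp. 80–82, Prop. 16 p. 96.
* [Omeara1963] O. T. O'Meara, *Introduction to Quadratic Forms* (1963), §11, §63.
-/

set_option autoImplicit false

noncomputable section

open scoped MatrixGroups WithZero
open Matrix

namespace Literature.NumberTheory.Automorphic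

namespace UnitaryGroup

open Literature.NumberTheory.Automorphic.HermitianLattice

variable {K : Type*} [Field K] [Valued K ℤᵐ⁰] {ϖ : K}
  (σ : K →+* K) {J : Matrix (Fin 3) (Fin 3) K} (hJ : J = (StdForm.antidiagonal 3).over K)

/-! ## §1 `r` and `N(A)` eliminated; `det M_h` -/

include hJ in
/-- **`r = −A·σ(q) ∕ σ(s)`**, `A = 1 + 4ϖb` (apply `σ` to (U3) `σA·q + σr·s = 0`; `σs ≠ 0` since `|s| = 1`). [cite: Flicker1998UnitaryFL, Prop. 4 p. 82] -/
theorem stabilizer_r_eq (hd : LocalConjDatum σ ϖ) {h : ↥(unitaryGroupOfForm σ J)} {b q r s : K}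
    (hh : ((h : GL (Fin 3) K) : Matrix (Fin 3) (Fin 3) K) = !![1 + 2 * ϖ * b, q, b; 2 * ϖ * r, s, r; 4 * ϖ ^ 2 * b, 2 * ϖ * q, 1 + 2 * ϖ * b]) :
    r = -((1 + 4 * ϖ * b) * σ q) / σ s := by
  obtain ⟨-, -, hU3⟩ := stabilizer_unitarity_relations σ hJ hd hh
  obtain ⟨hs, -, -, -⟩ := stabilizer_valuation_bounds σ hJ hd hh
  have hσs : σ s ≠ 0 := fun h0 => by
    have h1 : Valued.v (σ s) = 1 := by rw [hd.vσ, hs]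
    rw [h0, map_zero] at h1; exact zero_ne_one h1
  -- apply `σ` to (U3): `A σq + r σs = 0`
  have h := congrArg σ hU3
  rw [map_add, map_mul, map_mul, hd.σσ, hd.σσ, map_zero] at h
  rw [eq_div_iff hσs]
  linear_combination h

include hJ in
/-- **`|r| = |q|`** on `Stab(w₀)` (`r = −Aσq∕σs`, `|A| = |s| = 1`, `|σx| = |x|`). [cite: Flicker1998UnitaryFL, Prop. 4 p. 82] -/
theorem stabilizer_v_r_eq_v_q (hd : LocalConjDatum σ ϖ) {h : ↥(unitaryGroupOfForm σ J)} {b q r s : K}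
    (hh : ((h : GL (Fin 3) K) : Matrix (Fin 3) (Fin 3) K) = !![1 + 2 * ϖ * b, q, b; 2 * ϖ * r, s, r; 4 * ϖ ^ 2 * b, 2 * ϖ * q, 1 + 2 * ϖ * b]) :
    Valued.v r = Valued.v q := by
  obtain ⟨hs, -, hA, -⟩ := stabilizer_valuation_bounds σ hJ hd hh
  rw [stabilizer_r_eq σ hJ hd hh, map_div₀, Valuation.map_neg, map_mul, hA, one_mul, hd.vσ, hd.vσ, hs, div_one]

include hJ in
/-- **`N(A) = N(s)`**, `A = 1 + 4ϖb`, `N(x) = σx·x`: substitute `r = −Aσq∕σs` into (U1) `N(A) + 4ϖN(r) = 1` and use (U2) `N(s) + 4ϖN(q) = 1`.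
[cite: Flicker1998UnitaryFL, Prop. 4 p. 82; Prop. 16 p. 96] -/
theorem stabilizer_norm_A_eq_norm_s (hd : LocalConjDatum σ ϖ) {h : ↥(unitaryGroupOfForm σ J)} {b q r s : K}
    (hh : ((h : GL (Fin 3) K) : Matrix (Fin 3) (Fin 3) K) = !![1 + 2 * ϖ * b, q, b; 2 * ϖ * r, s, r; 4 * ϖ ^ 2 * b, 2 * ϖ * q, 1 + 2 * ϖ * b]) :
    σ (1 + 4 * ϖ * b) * (1 + 4 * ϖ * b) = σ s * s := by
  obtain ⟨hU1, hU2, -⟩ := stabilizer_unitarity_relations σ hJ hd hh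
  obtain ⟨hs, -, -, -⟩ := stabilizer_valuation_bounds σ hJ hd hh
  have hs0 : s ≠ 0 := fun h0 => by rw [h0, map_zero] at hs; exact zero_ne_one hs
  have hσs : σ s ≠ 0 := fun h0 => by
    have h1 : Valued.v (σ s) = 1 := by rw [hd.vσ, hs]
    rw [h0, map_zero] at h1; exact zero_ne_one h1
  have hr := stabilizer_r_eq σ hJ hd hh
  have hσr : σ r = -(σ (1 + 4 * ϖ * b) * q) / s := by
    rw [hr, map_div₀, map_neg, map_mul, hd.σσ, hd.σσ]
  -- `N(r)·N(s) = N(A)·N(q)`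
  have hrr : σ r * r * (σ s * s) = σ (1 + 4 * ϖ * b) * (1 + 4 * ϖ * b) * (σ q * q) := by
    rw [hσr, hr]
    field_simp
  linear_combination (σ s * s) * hU1 - 4 * ϖ * hrr - (σ (1 + 4 * ϖ * b) * (1 + 4 * ϖ * b)) * hU2

include hJ in
/-- **`det M_h = A·s − 4ϖ·q·r = A ∕ σ(s)`** for the `2 × 2` model `M_h = [[A, q], [4ϖr, s]]` (`r = −Aσq∕σs` and (U2)). [cite: Flicker1998UnitaryFL, Prop. 16 p. 96] -/
theorem det_stabilizerModel_eq (hd : LocalConjDatum σ ϖ) {h : ↥(unitaryGroupOfForm σ J)} {b q r s : K}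
    (hh : ((h : GL (Fin 3) K) : Matrix (Fin 3) (Fin 3) K) = !![1 + 2 * ϖ * b, q, b; 2 * ϖ * r, s, r; 4 * ϖ ^ 2 * b, 2 * ϖ * q, 1 + 2 * ϖ * b]) :
    (!![1 + 4 * ϖ * b, q; 4 * ϖ * r, s] : Matrix (Fin 2) (Fin 2) K).det = (1 + 4 * ϖ * b) / σ s := by
  obtain ⟨-, hU2, -⟩ := stabilizer_unitarity_relations σ hJ hd hh
  obtain ⟨hs, -, -, -⟩ := stabilizer_valuation_bounds σ hJ hd hh
  have hσs : σ s ≠ 0 := fun h0 => by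
    have h1 : Valued.v (σ s) = 1 := by rw [hd.vσ, hs]
    rw [h0, map_zero] at h1; exact zero_ne_one h1
  rw [Matrix.det_fin_two_of, stabilizer_r_eq σ hJ hd hh, eq_div_iff hσs]
  field_simp
  linear_combination (1 + 4 * ϖ * b) * hU2

include hJ in
/-- **`|det M_h| = 1`.** [cite: Flicker1998UnitaryFL, Prop. 16 p. 96] -/
theorem v_det_stabilizerModel (hd : LocalConjDatum σ ϖ) {h : ↥(unitaryGroupOfForm σ J)} {b q r s : K}
    (hh : ((h : GL (Fin 3) K) : Matrix (Fin 3) (Fin 3) K) = !![1 + 2 * ϖ * b, q, b; 2 * ϖ * r, s, r; 4 * ϖ ^ 2 * b, 2 * ϖ * q, 1 + 2 * ϖ * b]) :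
    Valued.v ((!![1 + 4 * ϖ * b, q; 4 * ϖ * r, s] : Matrix (Fin 2) (Fin 2) K).det) = 1 := by
  obtain ⟨hs, -, hA, -⟩ := stabilizer_valuation_bounds σ hJ hd hh
  rw [det_stabilizerModel_eq σ hJ hd hh, map_div₀, hA, hd.vσ, hs, div_one]

/-! ## §2 `H′_m` by two congruences: `|q| ≤ |ϖ^m|`, `|A − 1| ≤ |ϖ^{2m+1}|` -/

include hJ in
/-- **`H′_m = {h ∈ Stab(w₀) : |q| ≤ |ϖ^m| ∧ |A − 1| ≤ |ϖ^{2m+1}|}`**, `A − 1 = 4ϖb`: ★ (C′)'s four congruences `|q| ≤ |t|, |b| ≤ |t|², |r| ≤ |t|, |s| ≤ 1` (`t = ϖ^m`) with `|r| = |q|`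
and `|s| = 1` automatic on `Stab(w₀)` and `|b| ≤ |ϖ^m|² ⟺ |4ϖb| ≤ |ϖ^{2m+1}|` (`|4| = 1`) — Flicker's `{c ∈ π^m R_E, a∕u ≡ e (mod π^{1+2m})}`.
[cite: Flicker1998UnitaryFL, Prop. 4 p. 82; Prop. 16 p. 96] -/
theorem flickerDiag_conj_mem_unitaryInt_iff_two_congruences (hd : LocalConjDatum σ ϖ) (m : ℕ) {d h : ↥(unitaryGroupOfForm σ J)}
    (hdm : ((d : GL (Fin 3) K) : Matrix (Fin 3) (Fin 3) K) = !![ϖ ^ m, 0, 0; 0, 1, 0; 0, 0, (ϖ ^ m)⁻¹]) {b q r s : K}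
    (hh : ((h : GL (Fin 3) K) : Matrix (Fin 3) (Fin 3) K) = !![1 + 2 * ϖ * b, q, b; 2 * ϖ * r, s, r; 4 * ϖ ^ 2 * b, 2 * ϖ * q, 1 + 2 * ϖ * b]) :
    d⁻¹ * h * d ∈ unitaryInt σ J ↔
      Valued.v q ≤ Valued.v (ϖ ^ m) ∧ Valued.v (1 + 4 * ϖ * b - 1) ≤ Valued.v (ϖ ^ (2 * m + 1)) := by
  obtain ⟨hs, -, -, -⟩ := stabilizer_valuation_bounds σ hJ hd hh
  have hrq := stabilizer_v_r_eq_v_q σ hJ hd hh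
  have h4 : Valued.v (4 : K) = 1 := by rw [show (4 : K) = 2 * 2 by norm_num, map_mul, hd.v2, one_mul]
  have hϖ0 : Valued.v ϖ ≠ 0 := (Valuation.ne_zero_iff _).2 hd.ϖ_ne_zero
  have hb : Valued.v (1 + 4 * ϖ * b - 1) = Valued.v ϖ * Valued.v b := by
    rw [add_sub_cancel_left, map_mul, map_mul, h4, one_mul]
  have hpow : Valued.v (ϖ ^ (2 * m + 1)) = Valued.v ϖ * (Valued.v (ϖ ^ m) * Valued.v (ϖ ^ m)) := by
    rw [map_pow, map_pow, pow_succ, ← pow_add, ← two_mul, mul_comm]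
  rw [flickerDiag_inv_mul_mul_flickerDiag_mem_unitaryInt_iff σ hJ hd m hdm hh, hb, hpow, hrq, mul_le_mul_iff_right₀ (zero_lt_iff.2 hϖ0)]
  exact ⟨fun ⟨hq, hb', _, _⟩ => ⟨hq, hb'⟩, fun ⟨hq, hb'⟩ => ⟨hq, hb', hq, hs.le⟩⟩

/-! ## §3 The `2 × 2` model `M_h = [[A, q], [4ϖr, s]]` is multiplicative and determines `h` -/

omit [Valued K ℤᵐ⁰] in
/-- **`M_{hh′} = M_h · M_{h′}`**: the coordinates of a product of two stabiliser elements (read off the `3 × 3` product; the model is the matrix of `h` on `W = w₀^⊥` in the basis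
`f₁ = e₀ + 2ϖe₂`, `f₂ = e₁`). [cite: Flicker1998UnitaryFL, Prop. 4 p. 82; Prop. 16 p. 96] -/
theorem stabilizerModel_mul {h h' : ↥(unitaryGroupOfForm σ J)} {b q r s b' q' r' s' b'' q'' r'' s'' : K}
    (hh : ((h : GL (Fin 3) K) : Matrix (Fin 3) (Fin 3) K) = !![1 + 2 * ϖ * b, q, b; 2 * ϖ * r, s, r; 4 * ϖ ^ 2 * b, 2 * ϖ * q, 1 + 2 * ϖ * b])
    (hh' : ((h' : GL (Fin 3) K) : Matrix (Fin 3) (Fin 3) K) = !![1 + 2 * ϖ * b', q', b'; 2 * ϖ * r', s', r'; 4 * ϖ ^ 2 * b', 2 * ϖ * q', 1 + 2 * ϖ * b'])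
    (hhh' : (((h * h' : ↥(unitaryGroupOfForm σ J)) : GL (Fin 3) K) : Matrix (Fin 3) (Fin 3) K) =
      !![1 + 2 * ϖ * b'', q'', b''; 2 * ϖ * r'', s'', r''; 4 * ϖ ^ 2 * b'', 2 * ϖ * q'', 1 + 2 * ϖ * b'']) :
    (!![1 + 4 * ϖ * b'', q''; 4 * ϖ * r'', s''] : Matrix (Fin 2) (Fin 2) K) = !![1 + 4 * ϖ * b, q; 4 * ϖ * r, s] * !![1 + 4 * ϖ * b', q'; 4 * ϖ * r', s'] := by
  have hprod : (((h * h' : ↥(unitaryGroupOfForm σ J)) : GL (Fin 3) K) : Matrix (Fin 3) (Fin 3) K) =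
      ((h : GL (Fin 3) K) : Matrix (Fin 3) (Fin 3) K) * ((h' : GL (Fin 3) K) : Matrix (Fin 3) (Fin 3) K) := by
    rw [Subgroup.coe_mul, Units.val_mul]
  rw [hhh', hh, hh'] at hprod
  have e01 := congrFun (congrFun hprod 0) 1
  have e02 := congrFun (congrFun hprod 0) 2
  have e11 := congrFun (congrFun hprod 1) 1
  have e12 := congrFun (congrFun hprod 1) 2
  simp [Matrix.mul_apply, Fin.sum_univ_three] at e01 e02 e11 e12
  ext i j
  fin_cases i <;> fin_cases j <;> simp [Matrix.mul_apply, Fin.sum_univ_two]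
  · linear_combination 4 * ϖ * e02
  · linear_combination e01
  · linear_combination 4 * ϖ * e12
  · linear_combination e11

omit [Valued K ℤᵐ⁰] in
/-- **The model determines the element**: two stabiliser elements with the same `(A, q, r, s)` are equal (`b = (A − 1)∕4ϖ`, `4ϖ ≠ 0`). [cite: Flicker1998UnitaryFL, Prop. 4 p. 82] -/
theorem stabilizer_ext_of_model (hϖ : (4 : K) * ϖ ≠ 0) {h h' : ↥(unitaryGroupOfForm σ J)} {b q r s b' q' r' s' : K}
    (hh : ((h : GL (Fin 3) K) : Matrix (Fin 3) (Fin 3) K) = !![1 + 2 * ϖ * b, q, b; 2 * ϖ * r, s, r; 4 * ϖ ^ 2 * b, 2 * ϖ * q, 1 + 2 * ϖ * b])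
    (hh' : ((h' : GL (Fin 3) K) : Matrix (Fin 3) (Fin 3) K) = !![1 + 2 * ϖ * b', q', b'; 2 * ϖ * r', s', r'; 4 * ϖ ^ 2 * b', 2 * ϖ * q', 1 + 2 * ϖ * b'])
    (hM : (!![1 + 4 * ϖ * b, q; 4 * ϖ * r, s] : Matrix (Fin 2) (Fin 2) K) = !![1 + 4 * ϖ * b', q'; 4 * ϖ * r', s']) : h = h' := by
  have e00 := congrFun (congrFun hM 0) 0
  have e01 := congrFun (congrFun hM 0) 1
  have e10 := congrFun (congrFun hM 1) 0
  have e11 := congrFun (congrFun hM 1) 1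
  simp at e00 e01 e10 e11
  have h40 : (4 : K) ≠ 0 := fun h0 => hϖ (by rw [h0, zero_mul])
  have hϖ0 : ϖ ≠ 0 := fun h0 => hϖ (by rw [h0, mul_zero])
  have hb : b = b' := by rcases e00 with h | h | h; exacts [h, absurd h h40, absurd h hϖ0]
  have hr : r = r' := by rcases e10 with h | h | h; exacts [h, absurd h h40, absurd h hϖ0]
  apply Subtype.ext; apply Units.ext
  rw [hh, hh', hb, e01, hr, e11]

end UnitaryGroup

end Literature.NumberTheory.Automorphic

end
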